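import Summits.Ventures.CertifiedManyBodySolver.Theses.CovNdNiO2M21
import Summits.Ventures.CertifiedManyBodySolver.Downfold.BoxesNdNiO2M21QRowsKinematic
import HarnessLib

/-!
# Theorems/CovNdNiO2M21StubHighQ.lean — route «CovNdNiO2M21» (NdNiO₂ parent-film box M21, D-0154 (1)(C) COVERAGE (iii)), crux «ResidualHighUSlab»
# (stmt-Ventures-26752): the registered stub `stub_highQ` DISCHARGED — state-free, no certificate, no claim node

Supports stmt-Ventures-26752. The BC3 birth skeleton of this seat (`HOME(hubbard-obs)/hubbard-cov-ndnio2-box-2/births/ResidualHighUSlab_birth.lean`,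
registered skeleton `52a03cb7…`, 2026-08-28T08:07:27Z) composes `ResidualHighUSlab` from two stubs: `stub_highP` (the corner END objective
`P = −X₀(−23/50, 5)` on the station segment — certificate-bearing: today the two AF bundle claim nodes p657602 / p656818 of the closer
`covNdNiO2M21_ResidualHighUSlab_of_bundleNodes_AF`, p658251) and `stub_highQ` (the inner END objective `Q = −X₀(−11/25, 5)`). The `Q` stub is ONE-BODY
KINEMATICS: hubbard-cov-la214-box-2's state-free word `Downfold.ndM21_slotQ_orbitMean_ge_kinematic` (p636407; engine
`orbitMean_neg_oddMomentTT_lam_zero_ge_kinematic_of_gs` = torus-limit variational inequality + bathtub bridge on the `M = 128` kernel pair-table row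
`B(−11/25, 4221/8192) ≤ 0.2311160651`) gives `−0.4768946 ≤ |D₄|⁻¹ Σ_γ Re ω_γ(−X₀(−11/25, 5))` for EVERY torus limit of unit `(rectN x L, S^z = 0)`-sector
ground states of ANY `hubbardTorusTT' L 1 s U'` with `0 ≤ x ≤ 477/500`, and `0.4768946 ≤ 0.4779578` (margin `0.0010632`). The stub body below is the
registered signature VERBATIM (witness `vQ := fun _ _ => −0.4768946`). Seat hubbard-cov-ndnio2-box-2 g2 (`prover-hubbard-cov-ndnio2-box-2-g2-0`; births custody).
HONEST FRAMING: one-body kinematics, kernel-checked, zero solve, no claim node; nothing interaction-sensitive is certified; the crux «ResidualHighUSlab»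
stays OPEN (HELD «closed modulo nodes» by the pen, (α′) step (3)) on its `P` objective (stub `stub_highP`, certificate-bearing); certified stiffness-scale
CEILINGS on a SCREENING-GRADE downfolded box «box ⊂ NdNiO₂ PARENT (M21, film not superconducting)» = CONTROL / CALIBRATION + labelled heuristic (wording
class (xx1)); a ceiling never speaks to the presence or absence of superconductivity; not a `T_c` or phase sentence; nothing here is a statement about
NdNiO₂; NO item, rung leaf or summit statement is proved by this file.
References: E. H. Lieb, M. Loss, Duke Math. J. 71 (1993) 337, §8 Thm. 8.2 [LiebLoss1993]; T. Hazra, N. Verma, M. Randeria, PRX 9 (2019) 031049,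
eqs. (2)–(6) [HazraVermaRanderia2019]; D. J. Scalapino, S. R. White, S.-C. Zhang, PRB 47 (1993) 7995, §II [ScalapinoWhiteZhang1993].
-/

noncomputable section

namespace Summit.Ventures.CertifiedManyBodySolver.Theorems.CovNdNiO2M21Stubs

open Set Filter Topology
open Summit.Ventures.CertifiedManyBodySolver.Observables
open Summit.Ventures.CertifiedManyBodySolver.Downfold
open Literature.MathematicalPhysics.QuantumLattice Literature.MathematicalPhysics.QuantumLattice.ThermodynamicLimit
open Literature.Probability.LatticeModels
open Matrix HubbardWave0
open scoped BigOperators ComplexOrder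

/-- **Registered stub `stub_highQ` of stmt-Ventures-26752 (skeleton `52a03cb7…`), DISCHARGED state-free** — the signature VERBATIM from the birth skeleton:
an orbit-lower family `vQ` for the inner END objective `−X₀(−11/25, 5)` on the HIGH-U station segment `s ∈ [(−23/50)(2 − 5/(17/2)), (−11/25)(2 − 5/(13/2))]` at every density
`x ∈ [183/200, 477/500]`, priced `−vQ ≤ 4779578/10⁷`. Witness `vQ := fun _ _ => −0.4768946` (la214-box-2's kinematic word `ndM21_slotQ_orbitMean_ge_kinematic`;
`0.4768946 ≤ 0.4779578`); no ground-state certificate enters. [cite: LiebLoss1993, §8, Theorem 8.2] [cite: HazraVermaRanderia2019, eqs. (2)-(6)] -/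
theorem stub_highQ :
    ∃ vQ : ℝ → ℝ → ℝ,
    (∀ x ∈ Set.Icc (183 / 200 : ℝ) (477 / 500), ∀ s ∈ Set.Icc ((-23 / 50 : ℝ) * (2 - (5 : ℝ) / (17 / 2 : ℝ))) ((-11 / 25 : ℝ) * (2 - (5 : ℝ) / (13 / 2 : ℝ))),
      ∀ (ω : InfVolFermionState 2) (Ls : ℕ → ℕ) (ψ : ∀ L, Fock (Orb (FermionTorus 2 L))),
      Tendsto Ls atTop atTop →
      (∀ j, IsGroundStateInSector (hubbardTorusTT' (Ls j) 1 s (5 : ℝ)) (rectN x (Ls j)) 0 (ψ (Ls j))) →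
      (∀ j, star (ψ (Ls j)) ⬝ᵥ ψ (Ls j) = 1) → ω.IsTorusLimitOf ψ Ls →
      vQ x s ≤ ((Finset.univ : Finset (DihedralGroup 4)).card : ℝ)⁻¹ * ∑ g ∈ (Finset.univ : Finset (DihedralGroup 4)),
        (ω.expect (d4ShiftSet g 0 (Literature.Probability.LatticeModels.box 2 7))
          (fermionEmbed (PolySite.d4Emb g 0 (Literature.Probability.LatticeModels.box 2 7)) (-oddMomentObsTT (-11 / 25 : ℝ) (5 : ℝ) 0))).re)
    ∧ (∀ x ∈ Set.Icc (183 / 200 : ℝ) (477 / 500), ∀ s ∈ Set.Icc ((-23 / 50 : ℝ) * (2 - (5 : ℝ) / (17 / 2 : ℝ))) ((-11 / 25 : ℝ) * (2 - (5 : ℝ) / (13 / 2 : ℝ))),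
      -vQ x s ≤ (4779578 / 10000000 : ℝ)) := by
  refine ⟨fun _ _ => -(0.4768946 : ℝ), ?_, ?_⟩
  · intro x hx s _ ω Ls ψ hLs hψ h1 hω
    exact ndM21_slotQ_orbitMean_ge_kinematic 5 s 5 (by linarith [hx.1]) hx.2 ω Ls ψ hLs hψ h1 hω
  · intro x _ s _
    norm_num

end Summit.Ventures.CertifiedManyBodySolver.Theorems.CovNdNiO2M21Stubs

end
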